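import Mathlib.Combinatorics.SimpleGraph.Acyclic
import Mathlib.Data.Nat.Log
import Mathlib.Algebra.Order.Floor.Defs
import Mathlib.Analysis.SpecialFunctions.Exp
import HarnessLib

/-!
# Dimock, *Correlation functions for the Gross–Neveu model*, Appendix A: the weight function `Γ(X) = A^{|X|} Θ(X)`,
# `Θ(X) = inf_T Π_{ℓ∈T} θ(|ℓ|)`, `θ(s) = (2L^{d+1})^n` (`L^n < s ≤ L^{n+1}`) — DEFINED as printed, with the scaling
# (157) `θ({s/L}) = (2L^{d+1})⁻¹θ(s)` and the bound (158) `θ(s) ≤ s^{d+2}` PROVED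

statement-level skeleton of published theorems with citation tags; proofs where landed; nothing here is a claim about the Yang–Mills mass gap

**Citation header (reproduction of PUBLISHED work).** J. Dimock, *Correlation functions for the Gross–Neveu model*,
Rev. Math. Phys. **37** (2025) 2450060 = arXiv:2406.16799v2 [Dimock2025GNCorrelations], **Appendix A "The weight function
`Γ(X)`"**, p.28 L1–25 of the arXiv-v2 text layer `paper:arxiv-2406.16799` (equations (154)–(159)). Writer seat p11
(literature-prover-lit-balaban-p11-g15-0), YM LIT SWEEP item (c) D11; the paper is the sequel of [DimockYuan2024GNFlow]
(item D10, this directory), whose localized expansions `E = Σ_X E(X)` are normed with this weight (*"`‖E‖_{h,Γ} =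
sup_X ‖E(X)‖_h Γ(X)`"*, (25) p.5); *"The weight factor `Γ(X)` is the same as that used in [1]–[5]"* (Brydges–Dimock–Hurd,
Brydges–Yau, Dimock–Hurd).

**The printed text (p.28, verbatim).** *"We give the definition in dimension `d`. It is defined by `Γ(X) = A^{|X|}Θ(X)`
(154) Here `|X|` is the number of unit squares in the paved set `X`, so `|X|` is the volume of `X`. In `A^{|X|}` the `A` is
a sufficiently large constant depending on `L`, say `A = L^{d+2}`. Finally `Θ(X)` has the form `Θ(X) = inf_T Π_{ℓ∈T}
θ(|ℓ|)` (155) where the infimum is over all tree graphs `T` on the centers of the blocks in `X`. The `ℓ` are the lines in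
the graph and `|ℓ|` is the length in an `ℓ^∞` norm. The function `θ(s)` is defined by `θ(0) = θ(1) = 1` and for `s = 2,
3, …` `θ(s) = (2L^{d+1})^n` if `L^n < s ≤ L^{n+1}` (156) Then if `L^n < s ≤ L^{n+1}` we have `L^{n−1} < s/L ≤ L^n` and
so `L^{n−1} < {s/L} ≤ L^n` where `{x}` is the smallest integer greater than or equal to `x`. Therefore `θ` has the useful
scaling behavior `θ({s/L}) = (2L^{d+1})^{n−1} = (2L^{d+1})^{−1}θ(s)` (157) Note also that for `L^n < s ≤ L^{n+1}` `θ(s) =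
(2L^{d+1})^n = 2^n(L^n)^{d+1} ≤ 2^n s^{d+1} ≤ L^n s^{d+1} ≤ s^{d+2}` (158) Hence the bound holds for `s = 1, 2, 3…`. We
also will use a modification defining for positive integer `n` `Γ_n(X) = e^{n|X|}Γ(X)` (159)"*.

**Lean rendering.** Blocks are labelled by lattice points of `ℤ^d` (`Fin d → ℤ`; the unit square with that lower
corner — center-to-center `ℓ^∞` distances equal corner-to-corner ones); a paved set is a non-empty `X : Finset (Fin d → ℤ)`
with `|X| = #X`; a *tree graph on the centers of the blocks in `X`* is a `SimpleGraph ↥X` which `IsTree` (Mathlib), its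
lines are its edges `e : Sym2 ↥X`, `|ℓ| = lineLength` (the `ℓ^∞` distance of the endpoints, `supNorm`).
* `theta L d s` — (156), with `n = Nat.clog L s − 1`; **`theta_eq`** is (156) verbatim; `theta_zero`, `theta_one`;
* **`pow_lt_ceil_div_le`**, **`theta_ceil_div_mul`**, **`theta_ceil_div`** — (157) (`{x} = ⌈x⌉₊`, for `s > L`, i.e. `n ≥ 1`,
  which is the range where the printed `(2L^{d+1})^{n−1}` is meant);
* **`theta_le_pow`** — (158) with its printed chain of inequalities (`L ≥ 2`), for every `s ≥ 1`;
* `treeGraphs X`, `treeWeight L X T = Π_{ℓ∈T} θ(|ℓ|)`, **`Theta L X`** — (155) as a `Finset.inf'` over the (non-empty,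
  `treeGraphs_nonempty`: Mathlib's spanning trees) finite set of tree graphs; `Theta_le_treeWeight`,
  `exists_isTree_treeWeight_eq` (the infimum is a minimum), `one_le_Theta`, `Theta_singleton`;
* **`Gamma A L X = A^{#X} Θ(X)`** — (154); **`GammaN n A L X = e^{n #X} Γ(X)`** — (159); `pow_card_le_Gamma`, `Gamma_pos`,
  `Gamma_le_GammaN`, `Gamma_singleton`.
The lattice dimension `d` of `ℤ^d` and the exponent `d` of (156) are the same parameter. Not formalized here: the uses
of `Γ` in the body of the paper (norms (25), the bounds of §§2–4). No named facts, no `sorry`.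

(v1.1) **The two printed properties of `Γ` in the predecessor paper** J. Dimock, C. Yuan, *Structural stability of the RG
flow in the Gross–Neveu model*, AHP **25** (2024) = arXiv:2303.07916 [DimockYuan2024GNFlow], §2.2 p.10 L24–28 (same `Γ`,
(53)–(54) there): *"The weight factor `Γ(X)` satisfies `Γ(X) ≥ 1` and `Γ(X ∪ Y) ≤ Γ(X)Γ(Y)θ(d(X,Y))` (55) … `Γ_n(X) =
e^{n|X|}Γ(X)` (56) This also satisfies (55)."* — `one_le_Gamma`; `setDist X Y` (= `d(X,Y)`, the `ℓ^∞` distance between the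
block sets); **`Theta_union_le`** (the mechanism: join two optimal tree graphs by one line `{x,y}`, `x ∈ X`, `y ∈ Y`, take a
spanning tree of the connected union — Mathlib `Connected.exists_isTree_le` — and use `θ ≥ 1`), `Gamma_union_le`,
`GammaN_union_le` (pointwise forms, any `x ∈ X`, `y ∈ Y`), **`Gamma_union_le_setDist`** ((55) verbatim, `A ≥ 1`, `X, Y ≠ ∅`),
**`GammaN_union_le_setDist`** ((56)).
-/

noncomputable section

open Finset

namespace Literature.MathematicalPhysics.QuantumFieldTheory.DimockYuan2024

namespace WeightFunctionGamma

/-! ## (156): the function `θ(s)` -/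

/-- **The function `θ(s)` of (156)**: `θ(0) = θ(1) = 1` and `θ(s) = (2L^{d+1})^n` if `L^n < s ≤ L^{n+1}` (`s = 2, 3, …`);
here `n = ⌈log_L s⌉ − 1` (`Nat.clog`), which is that `n` (`theta_eq`). [cite: Dimock2025GNCorrelations, App. A (156) p.28 L14–16] -/
def theta (L d s : ℕ) : ℕ := if s ≤ 1 then 1 else (2 * L ^ (d + 1)) ^ (Nat.clog L s - 1)

/-- `θ(0) = 1`. [cite: Dimock2025GNCorrelations, App. A (156) p.28 L14–16] -/
@[simp] theorem theta_zero (L d : ℕ) : theta L d 0 = 1 := by simp [theta]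

/-- `θ(1) = 1`. [cite: Dimock2025GNCorrelations, App. A (156) p.28 L14–16] -/
@[simp] theorem theta_one (L d : ℕ) : theta L d 1 = 1 := by simp [theta]

/-- `L^n < s ≤ L^{n+1}` pins down `⌈log_L s⌉ = n + 1`. [folklore] -/
private theorem clog_eq_succ {L n s : ℕ} (hL : 1 < L) (h1 : L ^ n < s) (h2 : s ≤ L ^ (n + 1)) : Nat.clog L s = n + 1 := by
  have a : n < Nat.clog L s := (Nat.lt_clog_iff_pow_lt hL).2 h1
  have b : Nat.clog L s ≤ n + 1 := (Nat.clog_le_iff_le_pow hL).2 h2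
  omega

/-- **(156) as printed**: `θ(s) = (2L^{d+1})^n` if `L^n < s ≤ L^{n+1}`. [cite: Dimock2025GNCorrelations, App. A (156) p.28 L14–16] -/
theorem theta_eq {L d n s : ℕ} (hL : 1 < L) (h1 : L ^ n < s) (h2 : s ≤ L ^ (n + 1)) :
    theta L d s = (2 * L ^ (d + 1)) ^ n := by
  have hs : ¬s ≤ 1 := by
    have : 1 ≤ L ^ n := Nat.one_le_pow _ _ (by omega)
    omega
  rw [theta, if_neg hs, clog_eq_succ hL h1 h2, Nat.add_sub_cancel]

/-- Every `s ≥ 2` lies in exactly one of the ranges `L^n < s ≤ L^{n+1}` (existence). [folklore] -/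
private theorem exists_pow_lt_le {L s : ℕ} (hL : 1 < L) (hs : 2 ≤ s) : ∃ n, L ^ n < s ∧ s ≤ L ^ (n + 1) := by
  refine ⟨Nat.clog L s - 1, ?_, ?_⟩
  · have hpos : 0 < Nat.clog L s := Nat.clog_pos hL hs
    have : Nat.clog L s - 1 < Nat.clog L s := by omega
    exact (Nat.lt_clog_iff_pow_lt hL).1 this
  · have hpos : 0 < Nat.clog L s := Nat.clog_pos hL hs
    rw [Nat.sub_add_cancel hpos]
    exact (Nat.clog_le_iff_le_pow hL).1 le_rfl

/-- `θ(s) ≥ 1`. [cite: Dimock2025GNCorrelations, App. A (156) p.28 L14–16] -/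
theorem one_le_theta {L : ℕ} (hL : 1 ≤ L) (d s : ℕ) : 1 ≤ theta L d s := by
  unfold theta
  split_ifs
  · exact le_rfl
  · exact Nat.one_le_pow _ _ (by positivity)

/-! ## (157): the scaling behaviour `θ(⌈s/L⌉) = (2L^{d+1})⁻¹ θ(s)` -/

/-- **(157), first step**: *"if `L^n < s ≤ L^{n+1}` we have `L^{n−1} < s/L ≤ L^n` and so `L^{n−1} < {s/L} ≤ L^n` where `{x}` is
the smallest integer greater than or equal to `x`"* (here `n ≥ 1`; `{x} = ⌈x⌉₊`). [cite: Dimock2025GNCorrelations, App. A (157) p.28 L17–20] -/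
theorem pow_lt_ceil_div_le {L n s : ℕ} (hL : 1 < L) (hn : 1 ≤ n) (h1 : L ^ n < s) (h2 : s ≤ L ^ (n + 1)) :
    L ^ (n - 1) < ⌈(s : ℝ) / L⌉₊ ∧ ⌈(s : ℝ) / L⌉₊ ≤ L ^ n := by
  have hLpos : (0 : ℝ) < L := by exact_mod_cast (by omega : 0 < L)
  constructor
  · rw [Nat.lt_ceil, lt_div_iff₀ hLpos]
    have : ((L ^ (n - 1) : ℕ) : ℝ) * L = ((L ^ n : ℕ) : ℝ) := by
      push_cast
      rw [← pow_succ, Nat.sub_add_cancel hn]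
    rw [this]
    exact_mod_cast h1
  · rw [Nat.ceil_le, div_le_iff₀ hLpos]
    have : ((L ^ n : ℕ) : ℝ) * L = ((L ^ (n + 1) : ℕ) : ℝ) := by push_cast; rw [pow_succ]
    rw [this]
    exact_mod_cast h2

/-- **(157), the scaling behaviour**: `θ({s/L})·(2L^{d+1}) = θ(s)` for `s > L` (i.e. `θ({s/L}) = (2L^{d+1})^{n−1}` when
`L^n < s ≤ L^{n+1}`, `n ≥ 1`). [cite: Dimock2025GNCorrelations, App. A (157) p.28 L17–20] -/
theorem theta_ceil_div_mul {L d s : ℕ} (hL : 1 < L) (hs : L < s) :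
    theta L d ⌈(s : ℝ) / L⌉₊ * (2 * L ^ (d + 1)) = theta L d s := by
  obtain ⟨n, h1, h2⟩ := exists_pow_lt_le (s := s) hL (by omega)
  have hn : 1 ≤ n := by
    by_contra h0
    have : n = 0 := by omega
    subst this
    rw [zero_add, pow_one] at h2
    omega
  obtain ⟨h3, h4⟩ := pow_lt_ceil_div_le hL hn h1 h2
  have h4' : ⌈(s : ℝ) / L⌉₊ ≤ L ^ (n - 1 + 1) := by rwa [Nat.sub_add_cancel hn]
  rw [theta_eq hL h1 h2, theta_eq hL h3 h4', ← pow_succ, Nat.sub_add_cancel hn]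

/-- **(157) as printed**: `θ({s/L}) = (2L^{d+1})⁻¹ θ(s)` (`s > L`). [cite: Dimock2025GNCorrelations, App. A (157) p.28 L17–20] -/
theorem theta_ceil_div {L d s : ℕ} (hL : 1 < L) (hs : L < s) :
    (theta L d ⌈(s : ℝ) / L⌉₊ : ℝ) = (2 * (L : ℝ) ^ (d + 1))⁻¹ * theta L d s := by
  have hne : (2 * (L : ℝ) ^ (d + 1)) ≠ 0 := by positivity
  rw [eq_inv_mul_iff_mul_eq₀ hne, mul_comm]
  exact_mod_cast theta_ceil_div_mul (d := d) hL hs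

/-! ## (158): the bound `θ(s) ≤ s^{d+2}` -/

/-- **(158)**: for `L^n < s ≤ L^{n+1}`, `θ(s) = (2L^{d+1})^n = 2^n(L^n)^{d+1} ≤ 2^n s^{d+1} ≤ L^n s^{d+1} ≤ s^{d+2}` (`L ≥ 2`); *"Hence the
bound holds for `s = 1, 2, 3, …`"*. [cite: Dimock2025GNCorrelations, App. A (158) p.28 L21–23] -/
theorem theta_le_pow {L d s : ℕ} (hL : 2 ≤ L) (hs : 1 ≤ s) : theta L d s ≤ s ^ (d + 2) := by
  by_cases h1 : s = 1
  · subst h1; simp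
  obtain ⟨n, hn1, hn2⟩ := exists_pow_lt_le (L := L) (s := s) (by omega) (by omega)
  rw [theta_eq (by omega) hn1 hn2]
  calc (2 * L ^ (d + 1)) ^ n = 2 ^ n * (L ^ n) ^ (d + 1) := by rw [mul_pow, ← pow_mul, ← pow_mul, mul_comm (d + 1)]
    _ ≤ 2 ^ n * s ^ (d + 1) := Nat.mul_le_mul_left _ (Nat.pow_le_pow_left hn1.le _)
    _ ≤ L ^ n * s ^ (d + 1) := Nat.mul_le_mul_right _ (Nat.pow_le_pow_left hL _)
    _ ≤ s * s ^ (d + 1) := Nat.mul_le_mul_right _ hn1.le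
    _ = s ^ (d + 2) := by ring

/-! ## (155): `Θ(X)`, the infimum over tree graphs on the centers of the blocks of `X` -/

variable {d : ℕ}

/-- The `ℓ^∞` norm on `ℤ^d`. [cite: Dimock2025GNCorrelations, App. A (155) p.28 L7–14] -/
def supNorm (v : Fin d → ℤ) : ℕ := univ.sup fun i => (v i).natAbs

/-- `‖−v‖_∞ = ‖v‖_∞`. [folklore] -/
private theorem supNorm_neg (v : Fin d → ℤ) : supNorm (-v) = supNorm v := by
  simp [supNorm, Int.natAbs_neg]

/-- **The length `|ℓ|` of a line `ℓ = {x, y}` in the `ℓ^∞` norm** (blocks labelled by their lattice corners; the centers differ by a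
constant shift, so center-to-center and corner-to-corner lengths agree). [cite: Dimock2025GNCorrelations, App. A (155) p.28 L7–14] -/
def lineLength : Sym2 (Fin d → ℤ) → ℕ :=
  Sym2.lift ⟨fun x y => supNorm (x - y), fun x y => show supNorm (x - y) = supNorm (y - x) by rw [← supNorm_neg, neg_sub]⟩

/-- Unfolding: `|{x,y}| = ‖x − y‖_∞`. [cite: Dimock2025GNCorrelations, App. A (155) p.28 L7–14] -/
@[simp] theorem lineLength_mk (x y : Fin d → ℤ) : lineLength s(x, y) = supNorm (x - y) := rfl

open Classical in
/-- **The tree graphs `T` on the centers of the blocks in `X`** (spanning trees of the vertex set `X`). [cite: Dimock2025GNCorrelations, App. A (155) p.28 L7–14] -/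
def treeGraphs (X : Finset (Fin d → ℤ)) : Finset (SimpleGraph ↥X) := univ.filter fun T => T.IsTree

open Classical in
/-- The weight `Π_{ℓ∈T} θ(|ℓ|)` of a tree graph `T` on `X`. [cite: Dimock2025GNCorrelations, App. A (155) p.28 L7–14] -/
def treeWeight (L : ℕ) (X : Finset (Fin d → ℤ)) (T : SimpleGraph ↥X) : ℕ :=
  ∏ e ∈ T.edgeFinset, theta L d (lineLength (e.map Subtype.val))

/-- A non-empty finite vertex set carries a tree graph (a spanning tree of the complete graph; Mathlib). [folklore] -/
private theorem treeGraphs_nonempty {X : Finset (Fin d → ℤ)} (hX : X.Nonempty) : (treeGraphs X).Nonempty := by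
  classical
  haveI : Nonempty ↥X := hX.coe_sort
  obtain ⟨T, -, hT⟩ := (SimpleGraph.connected_top (V := ↥X)).exists_isTree_le
  exact ⟨T, by simp [treeGraphs, hT]⟩

/-- **`Θ(X) = inf_T Π_{ℓ∈T} θ(|ℓ|)`**, the infimum over all tree graphs `T` on the centers of the blocks in `X` (155) — a minimum over
a non-empty finite set for `X ≠ ∅`; the paper's paved sets are non-empty, and the junk value `Θ(∅) = 1` is never used. [cite: Dimock2025GNCorrelations, App. A (155) p.28 L7–14] -/
def Theta (L : ℕ) (X : Finset (Fin d → ℤ)) : ℕ :=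
  if hX : X.Nonempty then (treeGraphs X).inf' (treeGraphs_nonempty hX) (treeWeight L X) else 1

/-- `Θ(X) ≤ Π_{ℓ∈T} θ(|ℓ|)` for every tree graph `T` on `X` (the infimum property). [cite: Dimock2025GNCorrelations, App. A (155) p.28 L7–14] -/
theorem Theta_le_treeWeight (L : ℕ) {X : Finset (Fin d → ℤ)} {T : SimpleGraph ↥X} (hT : T.IsTree) :
    Theta L X ≤ treeWeight L X T := by
  classical
  have hX : X.Nonempty := by
    obtain ⟨⟨v, hv⟩⟩ := hT.connected.nonempty
    exact ⟨v, hv⟩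
  rw [Theta, dif_pos hX]
  exact Finset.inf'_le _ (by simp [treeGraphs, hT])

/-- The infimum (155) is attained at some tree graph. [cite: Dimock2025GNCorrelations, App. A (155) p.28 L7–14] -/
theorem exists_isTree_treeWeight_eq (L : ℕ) {X : Finset (Fin d → ℤ)} (hX : X.Nonempty) :
    ∃ T : SimpleGraph ↥X, T.IsTree ∧ treeWeight L X T = Theta L X := by
  classical
  rw [Theta, dif_pos hX]
  obtain ⟨T, hT, h⟩ := Finset.exists_mem_eq_inf' (treeGraphs_nonempty hX) (treeWeight L X)
  refine ⟨T, ?_, h.symm⟩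
  simpa [treeGraphs] using hT

/-- Every tree weight is `≥ 1` (`θ ≥ 1`). [cite: Dimock2025GNCorrelations, App. A (155) p.28 L7–14] -/
theorem one_le_treeWeight {L : ℕ} (hL : 1 ≤ L) (X : Finset (Fin d → ℤ)) (T : SimpleGraph ↥X) :
    1 ≤ treeWeight L X T := by
  classical
  unfold treeWeight
  exact Finset.one_le_prod' fun e _ => one_le_theta hL d _

/-- `Θ(X) ≥ 1`. [cite: Dimock2025GNCorrelations, App. A (155) p.28 L7–14] -/
theorem one_le_Theta {L : ℕ} (hL : 1 ≤ L) (X : Finset (Fin d → ℤ)) : 1 ≤ Theta L X := by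
  by_cases hX : X.Nonempty
  · obtain ⟨T, -, h⟩ := exists_isTree_treeWeight_eq L hX
    rw [← h]
    exact one_le_treeWeight hL X T
  · rw [Theta, dif_neg hX]

/-- A single block has `Θ = 1` (the only tree graph on one vertex has no lines). [cite: Dimock2025GNCorrelations, App. A (155) p.28 L7–14] -/
theorem Theta_singleton (L : ℕ) (x : Fin d → ℤ) : Theta L ({x} : Finset (Fin d → ℤ)) = 1 := by
  classical
  obtain ⟨T, hT, h⟩ := exists_isTree_treeWeight_eq L (Finset.singleton_nonempty x)
  rw [← h, treeWeight]
  have hcard := hT.card_edgeFinset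
  rw [Fintype.card_coe, Finset.card_singleton] at hcard
  have he : T.edgeFinset = ∅ := Finset.card_eq_zero.1 (by omega)
  rw [he, Finset.prod_empty]

/-! ## (154), (159): `Γ(X) = A^{|X|} Θ(X)` and `Γ_n(X) = e^{n|X|} Γ(X)` -/

/-- **The weight function `Γ(X) = A^{|X|} Θ(X)`** (154), `|X|` = the number of unit blocks in `X`; *"the `A` is a sufficiently large
constant depending on `L`, say `A = L^{d+2}`"*. [cite: Dimock2025GNCorrelations, App. A (154) p.28 L2–6] -/
def Gamma (A : ℝ) (L : ℕ) (X : Finset (Fin d → ℤ)) : ℝ := A ^ X.card * Theta L X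

/-- **The modification `Γ_n(X) = e^{n|X|} Γ(X)`** for positive integer `n` (159). [cite: Dimock2025GNCorrelations, App. A (159) p.28 L24–25] -/
def GammaN (n : ℕ) (A : ℝ) (L : ℕ) (X : Finset (Fin d → ℤ)) : ℝ := Real.exp (n * X.card) * Gamma A L X

/-- `A^{|X|} ≤ Γ(X)` for `A ≥ 0`. [cite: Dimock2025GNCorrelations, App. A (154) p.28 L2–6] -/
theorem pow_card_le_Gamma {A : ℝ} (hA : 0 ≤ A) {L : ℕ} (hL : 1 ≤ L) (X : Finset (Fin d → ℤ)) :
    A ^ X.card ≤ Gamma A L X := by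
  unfold Gamma
  have h1 : (1 : ℝ) ≤ Theta L X := by exact_mod_cast one_le_Theta hL X
  nlinarith [pow_nonneg hA X.card]

/-- `Γ(X) > 0` for `A > 0`. [cite: Dimock2025GNCorrelations, App. A (154) p.28 L2–6] -/
theorem Gamma_pos {A : ℝ} (hA : 0 < A) {L : ℕ} (hL : 1 ≤ L) (X : Finset (Fin d → ℤ)) : 0 < Gamma A L X := by
  unfold Gamma
  have h1 : (1 : ℝ) ≤ Theta L X := by exact_mod_cast one_le_Theta hL X
  positivity

/-- `Γ(X) ≤ Γ_n(X)`. [cite: Dimock2025GNCorrelations, App. A (159) p.28 L24–25] -/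
theorem Gamma_le_GammaN (n : ℕ) {A : ℝ} (hA : 0 < A) {L : ℕ} (hL : 1 ≤ L) (X : Finset (Fin d → ℤ)) :
    Gamma A L X ≤ GammaN n A L X := by
  unfold GammaN
  have h := Gamma_pos hA hL X
  have h1 : (1 : ℝ) ≤ Real.exp (n * X.card) := Real.one_le_exp (by positivity)
  nlinarith

/-- A single block has `Γ = A`. [cite: Dimock2025GNCorrelations, App. A (154) p.28 L2–6] -/
theorem Gamma_singleton (A : ℝ) (L : ℕ) (x : Fin d → ℤ) : Gamma A L ({x} : Finset (Fin d → ℤ)) = A := by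
  simp [Gamma, Theta_singleton]

/-! ## (v1.1) [DimockYuan2024GNFlow] §2.2 (55)–(56): `Γ(X) ≥ 1` and `Γ(X ∪ Y) ≤ Γ(X) Γ(Y) θ(d(X,Y))`

The same weight function in the predecessor paper (D10, (53)–(54) = (154)–(155) here), with the two properties it prints:
*"The weight factor `Γ(X)` satisfies `Γ(X) ≥ 1` and `Γ(X ∪ Y) ≤ Γ(X)Γ(Y)θ(d(X,Y))` (55) We also will use a modification
defining for positive integer `n` `Γ_n(X) = e^{n|X|}Γ(X)` (56) This also satisfies (55)."* (p.10 L24–28). -/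

/-- A product of factors `≥ 1` over a union is at most the product of the two products. [folklore] -/
private theorem prod_union_le {ι : Type*} [DecidableEq ι] {s t : Finset ι} {f : ι → ℕ} (hf : ∀ i, 1 ≤ f i) :
    ∏ i ∈ s ∪ t, f i ≤ (∏ i ∈ s, f i) * ∏ i ∈ t, f i := by
  calc ∏ i ∈ s ∪ t, f i = ∏ i ∈ s ∪ t \ s, f i := by rw [Finset.union_sdiff_self_eq_union]
    _ = (∏ i ∈ s, f i) * ∏ i ∈ t \ s, f i := Finset.prod_union Finset.disjoint_sdiff
    _ ≤ (∏ i ∈ s, f i) * ∏ i ∈ t, f i :=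
        Nat.mul_le_mul_left _ (Finset.prod_le_prod_of_subset_of_one_le' Finset.sdiff_subset fun i _ _ => hf i)

/-- **`Γ(X) ≥ 1`** (for `A ≥ 1`). [cite: DimockYuan2024GNFlow, §2.2 (55) p.10 L24–25] -/
theorem one_le_Gamma {A : ℝ} (hA : 1 ≤ A) {L : ℕ} (hL : 1 ≤ L) (X : Finset (Fin d → ℤ)) : 1 ≤ Gamma A L X :=
  (one_le_pow₀ hA).trans (pow_card_le_Gamma (zero_le_one.trans hA) hL X)

/-- **The tree-graph mechanism of (55)**: `Θ(X ∪ Y) ≤ Θ(X) Θ(Y) θ(|x − y|_∞)` for any blocks `x ∈ X`, `y ∈ Y` — join optimal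
tree graphs of `X` and of `Y` by the line `{x, y}`; the union is a connected graph on the centers of `X ∪ Y`, any of its
spanning trees has weight at most the product of all its `θ`-factors (`θ ≥ 1`). [cite: DimockYuan2024GNFlow, §2.2 (55) p.10 L24–25] -/
theorem Theta_union_le {L : ℕ} (hL : 1 ≤ L) {X Y : Finset (Fin d → ℤ)} {x y : Fin d → ℤ} (hx : x ∈ X) (hy : y ∈ Y) :
    Theta L (X ∪ Y) ≤ Theta L X * Theta L Y * theta L d (supNorm (x - y)) := by
  classical
  obtain ⟨TX, hTX, hwX⟩ := exists_isTree_treeWeight_eq L (X := X) ⟨x, hx⟩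
  obtain ⟨TY, hTY, hwY⟩ := exists_isTree_treeWeight_eq L (X := Y) ⟨y, hy⟩
  -- the inclusions of the two vertex sets into the union, the bridging pair
  set iX : ↥X ↪ ↥(X ∪ Y) := ⟨fun v => ⟨v.1, Finset.mem_union_left _ v.2⟩,
    fun a b h => Subtype.ext (Subtype.mk.inj h)⟩ with hiX
  set iY : ↥Y ↪ ↥(X ∪ Y) := ⟨fun v => ⟨v.1, Finset.mem_union_right _ v.2⟩,
    fun a b h => Subtype.ext (Subtype.mk.inj h)⟩ with hiY
  set x' : ↥(X ∪ Y) := ⟨x, Finset.mem_union_left _ hx⟩ with hx'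
  set y' : ↥(X ∪ Y) := ⟨y, Finset.mem_union_right _ hy⟩ with hy'
  -- the connected graph `T_X ∪ T_Y ∪ {x,y}` on the centers of `X ∪ Y`
  set H : SimpleGraph ↥(X ∪ Y) := TX.map iX ⊔ TY.map iY ⊔ SimpleGraph.edge x' y' with hH
  have hconn : H.Connected := by
    haveI : Nonempty ↥(X ∪ Y) := ⟨x'⟩
    suffices h : ∀ v, H.Reachable x' v from ⟨fun u v => (h u).symm.trans (h v)⟩
    intro v
    rcases Finset.mem_union.1 v.2 with hv | hv
    · have r : TX.Reachable ⟨x, hx⟩ ⟨v.1, hv⟩ := hTX.connected.preconnected _ _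
      have r' : (TX.map iX).Reachable (iX ⟨x, hx⟩) (iX ⟨v.1, hv⟩) :=
        r.map (SimpleGraph.Embedding.map iX TX).toHom
      have e2 : iX ⟨v.1, hv⟩ = v := Subtype.ext rfl
      rw [e2] at r'
      exact r'.mono (le_sup_left.trans le_sup_left)
    · have r : TY.Reachable ⟨y, hy⟩ ⟨v.1, hv⟩ := hTY.connected.preconnected _ _
      have r' : (TY.map iY).Reachable (iY ⟨y, hy⟩) (iY ⟨v.1, hv⟩) :=
        r.map (SimpleGraph.Embedding.map iY TY).toHom
      have e2 : iY ⟨v.1, hv⟩ = v := Subtype.ext rfl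
      rw [e2] at r'
      have rxy : H.Reachable x' y' := by
        by_cases hxy : x' = y'
        · rw [hxy]
        · refine SimpleGraph.Adj.reachable ?_
          rw [hH]
          refine Or.inr ?_
          rw [SimpleGraph.edge_adj]
          exact ⟨Or.inl ⟨rfl, rfl⟩, hxy⟩
      exact rxy.trans (r'.mono (le_sup_right.trans le_sup_left))
  obtain ⟨T, hTH, hT⟩ := hconn.exists_isTree_le
  have hθ1 : ∀ e : Sym2 ↥(X ∪ Y), 1 ≤ theta L d (lineLength (e.map Subtype.val)) := fun e => one_le_theta hL d _
  -- edges of `H`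
  have hsubT : T.edgeFinset ⊆ H.edgeFinset := by
    rw [← Finset.coe_subset, SimpleGraph.coe_edgeFinset, SimpleGraph.coe_edgeFinset]
    exact SimpleGraph.edgeSet_mono hTH
  have hHedges : H.edgeFinset ⊆ (TX.edgeFinset.map iX.sym2Map ∪ TY.edgeFinset.map iY.sym2Map) ∪ {s(x', y')} := by
    rw [← Finset.coe_subset]
    push_cast
    rw [hH, SimpleGraph.edgeSet_sup, SimpleGraph.edgeSet_sup, SimpleGraph.edgeSet_map, SimpleGraph.edgeSet_map]
    exact Set.union_subset_union subset_rfl SimpleGraph.edgeSet_edge_subset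
  -- the weights of the transported trees
  have hmapX : ∏ e ∈ TX.edgeFinset.map iX.sym2Map, theta L d (lineLength (e.map Subtype.val)) = Theta L X := by
    rw [Finset.prod_map, ← hwX]
    unfold treeWeight
    refine Finset.prod_congr rfl fun e _ => ?_
    rw [Function.Embedding.sym2Map_apply, Sym2.map_map]
    rfl
  have hmapY : ∏ e ∈ TY.edgeFinset.map iY.sym2Map, theta L d (lineLength (e.map Subtype.val)) = Theta L Y := by
    rw [Finset.prod_map, ← hwY]
    unfold treeWeight
    refine Finset.prod_congr rfl fun e _ => ?_
    rw [Function.Embedding.sym2Map_apply, Sym2.map_map]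
    rfl
  calc Theta L (X ∪ Y) ≤ treeWeight L (X ∪ Y) T := Theta_le_treeWeight L hT
    _ ≤ ∏ e ∈ (TX.edgeFinset.map iX.sym2Map ∪ TY.edgeFinset.map iY.sym2Map) ∪ {s(x', y')},
          theta L d (lineLength (e.map Subtype.val)) := by
        unfold treeWeight
        exact Finset.prod_le_prod_of_subset_of_one_le' (hsubT.trans hHedges) fun e _ _ => hθ1 e
    _ ≤ (∏ e ∈ TX.edgeFinset.map iX.sym2Map, theta L d (lineLength (e.map Subtype.val))) *
          (∏ e ∈ TY.edgeFinset.map iY.sym2Map, theta L d (lineLength (e.map Subtype.val))) *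
          ∏ e ∈ ({s(x', y')} : Finset (Sym2 ↥(X ∪ Y))), theta L d (lineLength (e.map Subtype.val)) :=
        (prod_union_le hθ1).trans (Nat.mul_le_mul_right _ (prod_union_le hθ1))
    _ = Theta L X * Theta L Y * theta L d (supNorm (x - y)) := by
        rw [hmapX, hmapY, Finset.prod_singleton]
        rfl

/-- `Γ(X ∪ Y) ≤ Γ(X) Γ(Y) θ(|x − y|_∞)` for any blocks `x ∈ X`, `y ∈ Y` (`A ≥ 1`; `|X ∪ Y| ≤ |X| + |Y|`). [cite: DimockYuan2024GNFlow, §2.2 (55) p.10 L24–25] -/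
theorem Gamma_union_le {A : ℝ} (hA : 1 ≤ A) {L : ℕ} (hL : 1 ≤ L) {X Y : Finset (Fin d → ℤ)} {x y : Fin d → ℤ}
    (hx : x ∈ X) (hy : y ∈ Y) :
    Gamma A L (X ∪ Y) ≤ Gamma A L X * Gamma A L Y * theta L d (supNorm (x - y)) := by
  classical
  have hA0 : 0 ≤ A := zero_le_one.trans hA
  have h1 : A ^ (X ∪ Y).card ≤ A ^ X.card * A ^ Y.card := by
    rw [← pow_add]
    exact pow_le_pow_right₀ hA (Finset.card_union_le X Y)
  have h2 : (Theta L (X ∪ Y) : ℝ) ≤ Theta L X * Theta L Y * theta L d (supNorm (x - y)) := by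
    exact_mod_cast Theta_union_le hL hx hy
  unfold Gamma
  calc A ^ (X ∪ Y).card * (Theta L (X ∪ Y) : ℝ)
      ≤ (A ^ X.card * A ^ Y.card) * (Theta L X * Theta L Y * theta L d (supNorm (x - y))) :=
        mul_le_mul h1 h2 (by positivity) (by positivity)
    _ = A ^ X.card * Theta L X * (A ^ Y.card * Theta L Y) * theta L d (supNorm (x - y)) := by ring

/-- `Γ_n(X ∪ Y) ≤ Γ_n(X) Γ_n(Y) θ(|x − y|_∞)` for any blocks `x ∈ X`, `y ∈ Y`. [cite: DimockYuan2024GNFlow, §2.2 (56) p.10 L26–28 («This also satisfies (55)»)] -/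
theorem GammaN_union_le (n : ℕ) {A : ℝ} (hA : 1 ≤ A) {L : ℕ} (hL : 1 ≤ L) {X Y : Finset (Fin d → ℤ)}
    {x y : Fin d → ℤ} (hx : x ∈ X) (hy : y ∈ Y) :
    GammaN n A L (X ∪ Y) ≤ GammaN n A L X * GammaN n A L Y * theta L d (supNorm (x - y)) := by
  classical
  have h1 : Real.exp (n * (X ∪ Y).card) ≤ Real.exp (n * X.card) * Real.exp (n * Y.card) := by
    rw [← Real.exp_add, Real.exp_le_exp, ← mul_add]
    exact mul_le_mul_of_nonneg_left (by exact_mod_cast Finset.card_union_le X Y) (Nat.cast_nonneg n)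
  have h2 := Gamma_union_le hA hL hx hy
  have hG : 0 ≤ Gamma A L (X ∪ Y) := (Gamma_pos (zero_lt_one.trans_le hA) hL _).le
  unfold GammaN
  calc Real.exp (n * (X ∪ Y).card) * Gamma A L (X ∪ Y)
      ≤ (Real.exp (n * X.card) * Real.exp (n * Y.card)) * (Gamma A L X * Gamma A L Y * theta L d (supNorm (x - y))) :=
        mul_le_mul h1 h2 hG (by positivity)
    _ = Real.exp (n * X.card) * Gamma A L X * (Real.exp (n * Y.card) * Gamma A L Y) * theta L d (supNorm (x - y)) := by
        ring

/-- **`d(X,Y)`**: the `ℓ^∞` distance between the centers of the blocks of `X` and of `Y` (minimum over pairs; junk value `0`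
if one of them is empty). [cite: DimockYuan2024GNFlow, §2.2 (55) p.10 L24–25] -/
def setDist (X Y : Finset (Fin d → ℤ)) : ℕ :=
  if h : (X ×ˢ Y).Nonempty then (X ×ˢ Y).inf' h (fun p => supNorm (p.1 - p.2)) else 0

/-- `d(X,Y) ≤ |x − y|_∞` for `x ∈ X`, `y ∈ Y`. [cite: DimockYuan2024GNFlow, §2.2 (55) p.10 L24–25] -/
theorem setDist_le {X Y : Finset (Fin d → ℤ)} {x y : Fin d → ℤ} (hx : x ∈ X) (hy : y ∈ Y) :
    setDist X Y ≤ supNorm (x - y) := by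
  have hp : (x, y) ∈ X ×ˢ Y := Finset.mem_product.2 ⟨hx, hy⟩
  rw [setDist, dif_pos ⟨(x, y), hp⟩]
  exact Finset.inf'_le (fun p : (Fin d → ℤ) × (Fin d → ℤ) => supNorm (p.1 - p.2)) hp

/-- `d(X,Y)` is attained at a pair of blocks. [cite: DimockYuan2024GNFlow, §2.2 (55) p.10 L24–25] -/
theorem exists_supNorm_eq_setDist {X Y : Finset (Fin d → ℤ)} (hX : X.Nonempty) (hY : Y.Nonempty) :
    ∃ x ∈ X, ∃ y ∈ Y, supNorm (x - y) = setDist X Y := by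
  have hne : (X ×ˢ Y).Nonempty := hX.product hY
  obtain ⟨p, hp, hpe⟩ := Finset.exists_mem_eq_inf' hne (fun p => supNorm (p.1 - p.2))
  obtain ⟨hx, hy⟩ := Finset.mem_product.1 hp
  exact ⟨p.1, hx, p.2, hy, by rw [setDist, dif_pos hne, hpe]⟩

/-- `Θ(X ∪ Y) ≤ Θ(X) Θ(Y) θ(d(X,Y))` for non-empty paved sets `X, Y`. [cite: DimockYuan2024GNFlow, §2.2 (55) p.10 L24–25] -/
theorem Theta_union_le_setDist {L : ℕ} (hL : 1 ≤ L) {X Y : Finset (Fin d → ℤ)} (hX : X.Nonempty) (hY : Y.Nonempty) :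
    Theta L (X ∪ Y) ≤ Theta L X * Theta L Y * theta L d (setDist X Y) := by
  obtain ⟨x, hx, y, hy, h⟩ := exists_supNorm_eq_setDist hX hY
  rw [← h]
  exact Theta_union_le hL hx hy

/-- **(55) as printed**: *"The weight factor `Γ(X)` satisfies `Γ(X) ≥ 1` and `Γ(X ∪ Y) ≤ Γ(X)Γ(Y)θ(d(X,Y))`"* — for non-empty
paved sets `X, Y` and `A ≥ 1`. [cite: DimockYuan2024GNFlow, §2.2 (55) p.10 L24–25] -/
theorem Gamma_union_le_setDist {A : ℝ} (hA : 1 ≤ A) {L : ℕ} (hL : 1 ≤ L) {X Y : Finset (Fin d → ℤ)}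
    (hX : X.Nonempty) (hY : Y.Nonempty) :
    Gamma A L (X ∪ Y) ≤ Gamma A L X * Gamma A L Y * theta L d (setDist X Y) := by
  obtain ⟨x, hx, y, hy, h⟩ := exists_supNorm_eq_setDist hX hY
  rw [← h]
  exact Gamma_union_le hA hL hx hy

/-- **(56)**: `Γ_n(X) = e^{n|X|}Γ(X)` *"also satisfies (55)"*: `Γ_n(X ∪ Y) ≤ Γ_n(X)Γ_n(Y)θ(d(X,Y))`. [cite: DimockYuan2024GNFlow, §2.2 (56) p.10 L26–28 («This also satisfies (55)»)] -/
theorem GammaN_union_le_setDist (n : ℕ) {A : ℝ} (hA : 1 ≤ A) {L : ℕ} (hL : 1 ≤ L) {X Y : Finset (Fin d → ℤ)}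
    (hX : X.Nonempty) (hY : Y.Nonempty) :
    GammaN n A L (X ∪ Y) ≤ GammaN n A L X * GammaN n A L Y * theta L d (setDist X Y) := by
  obtain ⟨x, hx, y, hy, h⟩ := exists_supNorm_eq_setDist hX hY
  rw [← h]
  exact GammaN_union_le n hA hL hx hy

end WeightFunctionGamma

end Literature.MathematicalPhysics.QuantumFieldTheory.DimockYuan2024
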